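import Mathlib
import HarnessLib
import Literature.MathematicalPhysics.QuantumFieldTheory.YangMillsOS
import Summits.QuantumFields.YangMills.Theses.PencilRigidity
import Summits.QuantumFields.YangMills.Theses.MirrorModularBoosts
import Summits.QuantumFields.YangMills.Theses.IsotropyFromPowerCounting

/-!
# Line `sign-centre-trichotomy` — crux stmt-QuantumFields-10604 `DiagonalMirrorRPR` (skeleton v1, line-writer seat, 2026-08-31)

HONEST FRAMING (director-ym R645-ym, verbatim obligation). The routes wanting this crux (MirrorModularBoosts r2 = decl of record,
PencilRigidity, IsotropyFromPowerCounting) conclude `YangMills` only through `WeakCouplingHypercubicLimit`-type existence legs that stay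
OPEN and summit-strength; this registered skeleton is a typed plan for ONE leaf, not progress on the Clay problem; the Yang–Mills mass gap
is NOT proved.

VERDICT OF RECORD ON THE LEAF (item evidence, 28 leads a1, c1–c25 + strategist r1, refuter re-derivations): `DiagonalMirrorRPR` AS TYPED is
`verdict: misstated` by OVER-UNIVERSALITY — it asks diagonal-frame reflection positivity of the limit for EVERY scheme with the curvature
package `W₁`, including negative-coupling and centre-blind schemes where no lever exists, while every sharing route's `closes` only ever feeds
it the weak-coupling scheme produced by its existence leg. The REPAIRED statement v3 (`Eliminable.restatedCrux_v3_holds`, p117149/p166938;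
`Cruxes/DiagonalMirrorRPR/REPAIR-TERMS-r1.md`) is already a TREE THEOREM, and the settled path is ONE route-planner edit per route
(`route edit --restate DiagonalMirrorRPR --statement @v3.term`, or `--drop DiagonalMirrorRPR` re-gluing through
`Eliminable.closes_without_diag[_mmb|_ifpc]`). CONSEQUENTLY: DO NOT STAFF stub-workers on the stubs below; they document where the
difficulty of the leaf AS TYPED sits, so that the census reads «misstated; repair pending (planner)», not «no skeleton».

WHY THIS FILE (and why it is coarser than lead c8/c25's `Lines/centre_twisted_swap_residual.lean`): the skeleton of record (c25, 3 stubs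
T⁺ / T_c⁻ / N⁻, composition `SignDichotomy.DiagonalMirrorRPR_mmb_of_signedTransport`) imports landed Theorems modules
(`PencilRigidityDiagonalMirrorRPRSignDichotomy`, `…Eliminable`, `…CentreTwistDefs`, the cover-insensitivity chain) whose hub oleans are UNBUILT on
2026-08-31 (invalidated by HarnessLib/Literature rebuilds after the routes went dormant; `lean check` / `crux write` answer rc 75
`remote:stale:…:unbuilt:…`), and every earlier registration pointed at a swept session folder. This file is PORTABLE: it imports only the three
route files + `YangMillsOS`, re-proves the elementary part of the sign dichotomy inline (subsequence schemes keep `W₁`; every real sequence has a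
subsequence that is everywhere `≥ 0` or everywhere `< 0`; the conclusion does not mention the scheme), and registers THREE stubs that are c25's
stubs FOLLOWED BY the landed cover-insensitivity ⇒ diagonal-frame-RP transfer (so each stub here = c25's stub ∘ a tree theorem):
* `stub_nonnegCouplings`  (= c25 `transportNonnegCouplings` T⁺ ∘ `diagonalFrameRP_of_coverInsensitivityOffDiag`): `W₁` with `β_k ≥ 0` for
  all `k` ⇒ diagonal-frame RP of the limit. Content: RP of the 45°-TILTED-cover lattice measure (Wilson action is RP for β ≥ 0 in every
  lattice reflection [OsterwalderSeiler1978]) + identification of the tilted-cover limit with the hypercubic limit (cross-geometry identity —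
  NOT in `W₁`: this is exactly the over-universality; Borgs–Kotecký-type universality is known only in cluster-expansion regimes).
* `stub_centreNegCouplings` (= c25 T_c⁻ ∘ transfer): all `β_k < 0` but `−1 ∈ ρ(centre)`: the centre twist `U ↦ zU` on a sublattice maps
  `β ↦ −β` plaquette-wise on EVEN tori, reducing to the previous case; odd tori / the cross-geometry identity remain.
* `stub_centreBlindNegCouplings` (= c25 N⁻): all `β_k < 0`, `−1 ∉ ρ(centre)`: LEVERLESS (no reflection positivity known for frustrated Wilson
  actions) — the honest «misstated» residue.
`DiagonalMirrorRPR_of_subs : NonnegCouplings → CentreNegCouplings → CentreBlindNegCouplings → <crux body>` is kernel-checked and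
`DiagonalMirrorRPR_of : MirrorModularBoosts.DiagonalMirrorRPR` (from the three `stub_*`) concludes the item's decl of record BY NAME;
`_of_PencilRigidity`, `_of_IsotropyFromPowerCounting` conclude the verbatim copies (`Iff.rfl`). `sorry` occurs EXACTLY in the three `stub_*`.
Dead lines (item evidence): parity-bridge-cold-traces, kms-variance-lukewarm-descent, centre-twisted-swap (c4) — each died on the cross-geometry
identity / the leverless negative-coupling sector; this file does not claim to revive them. Negatives: stmt-QuantumFields-9665 `DiagonalMirrorRP`
(refuted: `S₁ 0` unconstrained) is NOT restated here — every stub keeps the full `W₁` (with `IsNormalized`) and the crux's own conclusion.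
-/

noncomputable section

open scoped BigOperators Topology SchwartzMap
open MeasureTheory Filter Set
open Literature.MathematicalPhysics.QuantumLattice Literature.MathematicalPhysics.AQFT
  Literature.MathematicalPhysics.QuantumFieldTheory

namespace Summit.QuantumFields.YangMills.Cruxes.DiagonalMirrorRPR.SignCentreTrichotomy

/-! ## The three children (crux body VERBATIM + one hypothesis on the sign of the couplings / the centre) -/

/-- Child `NonnegCouplings`: the crux restricted to schemes with `0 ≤ β_k` for every `k`. [folklore] -/
def NonnegCouplings : Prop :=
  open Literature.MathematicalPhysics.QuantumLattice Literature.MathematicalPhysics.AQFT Literature.MathematicalPhysics.QuantumFieldTheory in let E := EuclideanSpace ℝ (Fin 4); ∀ (G : Type) [Group G] [TopologicalSpace G] [IsTopologicalGroup G] [CompactSpace G], IsCompactSimpleLieGroup G → letI : MeasurableSpace G := borel G; haveI : BorelSpace G := ⟨rfl⟩; let W₁ := fun (r : LatticeRep G) (sch : SpeciesScheme (YMSpecies G)) (S₁ : SchwingerFamily E) => ((∀ (n : ℕ), n ≠ 0 → ∀ (f : Fin n → SchwartzMap (E) ℝ) (F : SchwartzMap (Fin n → E) ℂ), IsTensorOf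 F (fun i => ofRealTest (f i)) → IsOffDiagonal F → Filter.Tendsto (fun k : ℕ => ((latticeSchwinger r.ρ sch (fun s => s.F) k n (fun _ => r.curvature) f : ℝ) : ℂ)) Filter.atTop (nhds (S₁ n F))) ∧ (S₁.toLabelled.IsNormalized ∧ S₁.toLabelled.IsHermitian ∧ S₁.toLabelled.HasLinearGrowth ∧ S₁.toLabelled.IsReflectionPositive ∧ S₁.toLabelled.IsSymmetric ∧ S₁.toLabelled.HasClusterProperty) ∧ (∀ (n : ℕ) (a : E) (F : SchwartzMap (Fin n → E) ℂ), IsOffDiagonal F → S₁ n (translateMulti a F) = S₁ n F) ∧ (∀ (R : E ≃ₗᵢ[ℝ] E), LinearMap.det (R.toLinearEquiv : E →ₗ[ℝ] E) = 1 → (∀ i : Fin 4, ∃ j : Fin 4, R (EuclideanSpace.single i 1) = EuclideanSpace.single j 1 ∨ R (EuclideanSpace.single i 1) = -EuclideanSpace.single j 1) → ∀ (n : ℕ) (F : SchwartzMap (Fin n → E) ℂ), IsOffDiagonal F → S₁ n (linActMulti R F) = S₁ n F) ∧ (∃ Δ : ℝ, 0 < Δ ∧ S₁.toLabelled.HasMassGap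 Δ ∧ HasLatticeMassGap r sch Δ)); ∀ (r : LatticeRep G) (sch : SpeciesScheme (YMSpecies G)) (S₁ : SchwingerFamily E), W₁ r sch S₁ → (∀ k : ℕ, 0 ≤ sch.β k) → ∀ (R : E ≃ₗᵢ[ℝ] E) (a b : ℝ), a ^ 2 = 1 / 2 → b ^ 2 = 1 / 2 → R (EuclideanSpace.single 0 1) = a • EuclideanSpace.single 0 1 + b • EuclideanSpace.single 1 1 → (SchwingerFamily.toLabelled (fun n => (S₁ n).comp (linActMulti R))).IsReflectionPositive

/-- Child `CentreNegCouplings`: the crux restricted to schemes with `β_k < 0` for every `k`, for representations with `−1 ∈ ρ(Z(G))`. [folklore] -/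
def CentreNegCouplings : Prop :=
  open Literature.MathematicalPhysics.QuantumLattice Literature.MathematicalPhysics.AQFT Literature.MathematicalPhysics.QuantumFieldTheory in let E := EuclideanSpace ℝ (Fin 4); ∀ (G : Type) [Group G] [TopologicalSpace G] [IsTopologicalGroup G] [CompactSpace G], IsCompactSimpleLieGroup G → letI : MeasurableSpace G := borel G; haveI : BorelSpace G := ⟨rfl⟩; let W₁ := fun (r : LatticeRep G) (sch : SpeciesScheme (YMSpecies G)) (S₁ : SchwingerFamily E) => ((∀ (n : ℕ), n ≠ 0 → ∀ (f : Fin n → SchwartzMap (E) ℝ) (F : SchwartzMap (Fin n → E) ℂ), IsTensorOf F (fun i => ofRealTest (f i)) → IsOffDiagonal F → Filter.Tendsto (fun k : ℕ => ((latticeSchwinger r.ρ sch (fun s => s.F) k n (fun _ => r.curvature) f : ℝ) : ℂ)) Filter.atTop (nhds (S₁ n F))) ∧ (S₁.toLabelled.IsNormalized ∧ S₁.toLabelled.IsHermitian ∧ S₁.toLabelled.HasLinearGrowth ∧ S₁.toLabelled.IsReflectionPositive ∧ S₁.toLabelled.IsSymmetric ∧ S₁.toLabelled.HasClusterProperty)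 ∧ (∀ (n : ℕ) (a : E) (F : SchwartzMap (Fin n → E) ℂ), IsOffDiagonal F → S₁ n (translateMulti a F) = S₁ n F) ∧ (∀ (R : E ≃ₗᵢ[ℝ] E), LinearMap.det (R.toLinearEquiv : E →ₗ[ℝ] E) = 1 → (∀ i : Fin 4, ∃ j : Fin 4, R (EuclideanSpace.single i 1) = EuclideanSpace.single j 1 ∨ R (EuclideanSpace.single i 1) = -EuclideanSpace.single j 1) → ∀ (n : ℕ) (F : SchwartzMap (Fin n → E) ℂ), IsOffDiagonal F → S₁ n (linActMulti R F) = S₁ n F) ∧ (∃ Δ : ℝ, 0 < Δ ∧ S₁.toLabelled.HasMassGap Δ ∧ HasLatticeMassGap r sch Δ)); ∀ (r : LatticeRep G) (sch : SpeciesScheme (YMSpecies G)) (S₁ : SchwingerFamily E), W₁ r sch S₁ → (∃ z ∈ Subgroup.center G, r.ρ z = -1) → (∀ k : ℕ, sch.β k < 0) → ∀ (R : E ≃ₗᵢ[ℝ] E) (a b : ℝ), a ^ 2 = 1 / 2 → b ^ 2 = 1 / 2 → R (EuclideanSpace.single 0 1) = a • EuclideanSpace.single 0 1 + b • EuclideanSpace.single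 1 1 → (SchwingerFamily.toLabelled (fun n => (S₁ n).comp (linActMulti R))).IsReflectionPositive

/-- Child `CentreBlindNegCouplings`: the crux restricted to schemes with `β_k < 0` for every `k`, for representations with `−1 ∉ ρ(Z(G))` — the leverless residue. [folklore] -/
def CentreBlindNegCouplings : Prop :=
  open Literature.MathematicalPhysics.QuantumLattice Literature.MathematicalPhysics.AQFT Literature.MathematicalPhysics.QuantumFieldTheory in let E := EuclideanSpace ℝ (Fin 4); ∀ (G : Type) [Group G] [TopologicalSpace G] [IsTopologicalGroup G] [CompactSpace G], IsCompactSimpleLieGroup G → letI : MeasurableSpace G := borel G; haveI : BorelSpace G := ⟨rfl⟩; let W₁ := fun (r : LatticeRep G) (sch : SpeciesScheme (YMSpecies G)) (S₁ : SchwingerFamily E) => ((∀ (n : ℕ), n ≠ 0 → ∀ (f : Fin n → SchwartzMap (E) ℝ) (F : SchwartzMap (Fin n → E) ℂ), IsTensorOf F (fun i => ofRealTest (f i)) → IsOffDiagonal F → Filter.Tendsto (fun k : ℕ => ((latticeSchwinger r.ρ sch (fun s => s.F) k n (fun _ => r.curvature) f : ℝ) : ℂ)) Filter.atTop (nhds (S₁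 n F))) ∧ (S₁.toLabelled.IsNormalized ∧ S₁.toLabelled.IsHermitian ∧ S₁.toLabelled.HasLinearGrowth ∧ S₁.toLabelled.IsReflectionPositive ∧ S₁.toLabelled.IsSymmetric ∧ S₁.toLabelled.HasClusterProperty) ∧ (∀ (n : ℕ) (a : E) (F : SchwartzMap (Fin n → E) ℂ), IsOffDiagonal F → S₁ n (translateMulti a F) = S₁ n F) ∧ (∀ (R : E ≃ₗᵢ[ℝ] E), LinearMap.det (R.toLinearEquiv : E →ₗ[ℝ] E) = 1 → (∀ i : Fin 4, ∃ j : Fin 4, R (EuclideanSpace.single i 1) = EuclideanSpace.single j 1 ∨ R (EuclideanSpace.single i 1) = -EuclideanSpace.single j 1) → ∀ (n : ℕ) (F : SchwartzMap (Fin n → E) ℂ), IsOffDiagonal F → S₁ n (linActMulti R F) = S₁ n F) ∧ (∃ Δ : ℝ, 0 < Δ ∧ S₁.toLabelled.HasMassGap Δ ∧ HasLatticeMassGap r sch Δ)); ∀ (r : LatticeRep G) (sch : SpeciesScheme (YMSpecies G)) (S₁ : SchwingerFamily E), W₁ r sch S₁ → (¬ ∃ z ∈ Subgroup.center G, r.ρ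 z = -1) → (∀ k : ℕ, sch.β k < 0) → ∀ (R : E ≃ₗᵢ[ℝ] E) (a b : ℝ), a ^ 2 = 1 / 2 → b ^ 2 = 1 / 2 → R (EuclideanSpace.single 0 1) = a • EuclideanSpace.single 0 1 + b • EuclideanSpace.single 1 1 → (SchwingerFamily.toLabelled (fun n => (S₁ n).comp (linActMulti R))).IsReflectionPositive

/-! ## Registered stubs `stub_<name>` (`sorry` lives ONLY here) — DO NOT STAFF (leaf misstated; see header) -/

/-- **stub_nonnegCouplings** (= c25 T⁺ ∘ landed cover-insensitivity transfer). OPEN; needs the cross-geometry (tilted-cover = hypercubic) identification that `W₁` does not supply. Size L–XL. [OsterwalderSeiler1978; BorgsKotecky] -/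
theorem stub_nonnegCouplings : NonnegCouplings := by
  sorry

/-- **stub_centreNegCouplings** (= c25 T_c⁻ ∘ transfer). OPEN; centre twist `β ↦ −β` on even tori + the same identification. Size L. [OsterwalderSeiler1978; Seiler1982] -/
theorem stub_centreNegCouplings : CentreNegCouplings := by
  sorry

/-- **stub_centreBlindNegCouplings** (= c25 N⁻). OPEN and LEVERLESS (frustrated Wilson action, no RP known) — the «misstated» residue of the leaf as typed. Size XL / likely unprovable as stated. [Seiler1982] -/
theorem stub_centreBlindNegCouplings : CentreBlindNegCouplings := by
  sorry

/-! ## Glue (kernel-checked; no `sorry` below this line) -/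

/-- **Sign dichotomy along a subsequence.** Every real sequence has a strictly increasing subsequence along which it is
everywhere `≥ 0`, or one along which it is everywhere `< 0`. [folklore] -/
theorem exists_subseq_sign_dichotomy (u : ℕ → ℝ) :
    ∃ φ : ℕ → ℕ, StrictMono φ ∧ ((∀ k, 0 ≤ u (φ k)) ∨ (∀ k, u (φ k) < 0)) := by
  by_cases h : ∃ᶠ k in atTop, 0 ≤ u k
  · obtain ⟨φ, hφ, hφ'⟩ := Filter.extraction_of_frequently_atTop h
    exact ⟨φ, hφ, Or.inl hφ'⟩
  · have h' : ∀ᶠ k in atTop, u k < 0 := by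
      simpa [Filter.not_frequently, not_le] using h
    obtain ⟨φ, hφ, hφ'⟩ := Filter.extraction_of_eventually_atTop h'
    exact ⟨φ, hφ, Or.inr hφ'⟩

/-- **Sub-schemes exist**: along a strictly increasing `φ` there is a scheme (all data composed with
`φ`) whose lattice `n`-point functions of the curvature are the re-indexed ones (definitionally),
whose couplings are `β ∘ φ`, and which keeps every uniform lattice mass gap. [folklore] -/
theorem exists_subseqScheme {G : Type} [Group G] [TopologicalSpace G] [IsTopologicalGroup G]
    [CompactSpace G] [MeasurableSpace G] [BorelSpace G] (r : LatticeRep G)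
    (sch : SpeciesScheme (YMSpecies G)) (φ : ℕ → ℕ) (hφ : StrictMono φ) :
    ∃ sch' : SpeciesScheme (YMSpecies G),
      (∀ (k n : ℕ) (f : Fin n → 𝓢(EuclideanSpace ℝ (Fin 4), ℝ)),
          latticeSchwinger r.ρ sch' (fun s => s.F) k n (fun _ => r.curvature) f =
            latticeSchwinger r.ρ sch (fun s => s.F) (φ k) n (fun _ => r.curvature) f) ∧
        (sch'.β = fun k => sch.β (φ k)) ∧
        ∀ Δ : ℝ, HasLatticeMassGap r sch Δ → HasLatticeMassGap r sch' Δ := by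
  refine ⟨{ a := fun k => sch.a (φ k)
            a_pos := fun k => sch.a_pos (φ k)
            tendsto_a := sch.tendsto_a.comp hφ.tendsto_atTop
            β := fun k => sch.β (φ k)
            L := fun k => sch.L (φ k)
            tendsto_L := sch.tendsto_L.comp hφ.tendsto_atTop
            c := fun s k => sch.c s (φ k)
            m := fun s k => sch.m s (φ k) }, fun _ _ _ => rfl, rfl, ?_⟩
  intro Δ h A B
  obtain ⟨C, hC⟩ := h A B
  exact ⟨C, hφ.tendsto_atTop.eventually hC⟩


/-- **The split, literal form** (`NonnegCouplings → CentreNegCouplings → CentreBlindNegCouplings → <crux body>`, every body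
VERBATIM): pass to a subsequence scheme on which the couplings have a constant sign (the curvature package `W₁` is
subsequence-invariant; the conclusion does not mention the scheme), then split on `−1 ∈ ρ(Z(G))`. [folklore] -/
theorem DiagonalMirrorRPR_of_subs :
    (let E := EuclideanSpace ℝ (Fin 4); ∀ (G : Type) [Group G] [TopologicalSpace G] [IsTopologicalGroup G] [CompactSpace G], IsCompactSimpleLieGroup G → letI : MeasurableSpace G := borel G; haveI : BorelSpace G := ⟨rfl⟩; let W₁ := fun (r : LatticeRep G) (sch : SpeciesScheme (YMSpecies G)) (S₁ : SchwingerFamily E) => ((∀ (n : ℕ), n ≠ 0 → ∀ (f : Fin n → SchwartzMap (E) ℝ) (F : SchwartzMap (Fin n → E) ℂ), IsTensorOf F (fun i => ofRealTest (f i)) → IsOffDiagonal F → Filter.Tendsto (fun k : ℕ => ((latticeSchwinger r.ρ sch (fun s => s.F) k n (fun _ => r.curvature) f : ℝ) : ℂ)) Filter.atTop (nhds (S₁ n F))) ∧ (S₁.toLabelled.IsNormalized ∧ S₁.toLabelled.IsHermitian ∧ S₁.toLabelled.HasLinearGrowth ∧ S₁.toLabelled.IsReflectionPositive ∧ S₁.toLabelled.IsSymmetric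 ∧ S₁.toLabelled.HasClusterProperty) ∧ (∀ (n : ℕ) (a : E) (F : SchwartzMap (Fin n → E) ℂ), IsOffDiagonal F → S₁ n (translateMulti a F) = S₁ n F) ∧ (∀ (R : E ≃ₗᵢ[ℝ] E), LinearMap.det (R.toLinearEquiv : E →ₗ[ℝ] E) = 1 → (∀ i : Fin 4, ∃ j : Fin 4, R (EuclideanSpace.single i 1) = EuclideanSpace.single j 1 ∨ R (EuclideanSpace.single i 1) = -EuclideanSpace.single j 1) → ∀ (n : ℕ) (F : SchwartzMap (Fin n → E) ℂ), IsOffDiagonal F → S₁ n (linActMulti R F) = S₁ n F) ∧ (∃ Δ : ℝ, 0 < Δ ∧ S₁.toLabelled.HasMassGap Δ ∧ HasLatticeMassGap r sch Δ)); ∀ (r : LatticeRep G) (sch : SpeciesScheme (YMSpecies G)) (S₁ : SchwingerFamily E), W₁ r sch S₁ → (∀ k : ℕ, 0 ≤ sch.β k) → ∀ (R : E ≃ₗᵢ[ℝ] E) (a b : ℝ), a ^ 2 = 1 / 2 → b ^ 2 = 1 / 2 → R (EuclideanSpace.single 0 1) = a • EuclideanSpace.single 0 1 + b • EuclideanSpace.single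 1 1 → (SchwingerFamily.toLabelled (fun n => (S₁ n).comp (linActMulti R))).IsReflectionPositive) →
    (let E := EuclideanSpace ℝ (Fin 4); ∀ (G : Type) [Group G] [TopologicalSpace G] [IsTopologicalGroup G] [CompactSpace G], IsCompactSimpleLieGroup G → letI : MeasurableSpace G := borel G; haveI : BorelSpace G := ⟨rfl⟩; let W₁ := fun (r : LatticeRep G) (sch : SpeciesScheme (YMSpecies G)) (S₁ : SchwingerFamily E) => ((∀ (n : ℕ), n ≠ 0 → ∀ (f : Fin n → SchwartzMap (E) ℝ) (F : SchwartzMap (Fin n → E) ℂ), IsTensorOf F (fun i => ofRealTest (f i)) → IsOffDiagonal F → Filter.Tendsto (fun k : ℕ => ((latticeSchwinger r.ρ sch (fun s => s.F) k n (fun _ => r.curvature) f : ℝ) : ℂ)) Filter.atTop (nhds (S₁ n F))) ∧ (S₁.toLabelled.IsNormalized ∧ S₁.toLabelled.IsHermitian ∧ S₁.toLabelled.HasLinearGrowth ∧ S₁.toLabelled.IsReflectionPositive ∧ S₁.toLabelled.IsSymmetric ∧ S₁.toLabelled.HasClusterProperty) ∧ (∀ (n : ℕ) (a : E) (F : SchwartzMap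 (Fin n → E) ℂ), IsOffDiagonal F → S₁ n (translateMulti a F) = S₁ n F) ∧ (∀ (R : E ≃ₗᵢ[ℝ] E), LinearMap.det (R.toLinearEquiv : E →ₗ[ℝ] E) = 1 → (∀ i : Fin 4, ∃ j : Fin 4, R (EuclideanSpace.single i 1) = EuclideanSpace.single j 1 ∨ R (EuclideanSpace.single i 1) = -EuclideanSpace.single j 1) → ∀ (n : ℕ) (F : SchwartzMap (Fin n → E) ℂ), IsOffDiagonal F → S₁ n (linActMulti R F) = S₁ n F) ∧ (∃ Δ : ℝ, 0 < Δ ∧ S₁.toLabelled.HasMassGap Δ ∧ HasLatticeMassGap r sch Δ)); ∀ (r : LatticeRep G) (sch : SpeciesScheme (YMSpecies G)) (S₁ : SchwingerFamily E), W₁ r sch S₁ → (∃ z ∈ Subgroup.center G, r.ρ z = -1) → (∀ k : ℕ, sch.β k < 0) → ∀ (R : E ≃ₗᵢ[ℝ] E) (a b : ℝ), a ^ 2 = 1 / 2 → b ^ 2 = 1 / 2 → R (EuclideanSpace.single 0 1) = a • EuclideanSpace.single 0 1 + b • EuclideanSpace.single 1 1 → (SchwingerFamily.toLabelled (fun n =>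 (S₁ n).comp (linActMulti R))).IsReflectionPositive) →
    (let E := EuclideanSpace ℝ (Fin 4); ∀ (G : Type) [Group G] [TopologicalSpace G] [IsTopologicalGroup G] [CompactSpace G], IsCompactSimpleLieGroup G → letI : MeasurableSpace G := borel G; haveI : BorelSpace G := ⟨rfl⟩; let W₁ := fun (r : LatticeRep G) (sch : SpeciesScheme (YMSpecies G)) (S₁ : SchwingerFamily E) => ((∀ (n : ℕ), n ≠ 0 → ∀ (f : Fin n → SchwartzMap (E) ℝ) (F : SchwartzMap (Fin n → E) ℂ), IsTensorOf F (fun i => ofRealTest (f i)) → IsOffDiagonal F → Filter.Tendsto (fun k : ℕ => ((latticeSchwinger r.ρ sch (fun s => s.F) k n (fun _ => r.curvature) f : ℝ) : ℂ)) Filter.atTop (nhds (S₁ n F))) ∧ (S₁.toLabelled.IsNormalized ∧ S₁.toLabelled.IsHermitian ∧ S₁.toLabelled.HasLinearGrowth ∧ S₁.toLabelled.IsReflectionPositive ∧ S₁.toLabelled.IsSymmetric ∧ S₁.toLabelled.HasClusterProperty) ∧ (∀ (n : ℕ) (a : E) (F : SchwartzMap (Fin n → E) ℂ), IsOffDiagonal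 F → S₁ n (translateMulti a F) = S₁ n F) ∧ (∀ (R : E ≃ₗᵢ[ℝ] E), LinearMap.det (R.toLinearEquiv : E →ₗ[ℝ] E) = 1 → (∀ i : Fin 4, ∃ j : Fin 4, R (EuclideanSpace.single i 1) = EuclideanSpace.single j 1 ∨ R (EuclideanSpace.single i 1) = -EuclideanSpace.single j 1) → ∀ (n : ℕ) (F : SchwartzMap (Fin n → E) ℂ), IsOffDiagonal F → S₁ n (linActMulti R F) = S₁ n F) ∧ (∃ Δ : ℝ, 0 < Δ ∧ S₁.toLabelled.HasMassGap Δ ∧ HasLatticeMassGap r sch Δ)); ∀ (r : LatticeRep G) (sch : SpeciesScheme (YMSpecies G)) (S₁ : SchwingerFamily E), W₁ r sch S₁ → (¬ ∃ z ∈ Subgroup.center G, r.ρ z = -1) → (∀ k : ℕ, sch.β k < 0) → ∀ (R : E ≃ₗᵢ[ℝ] E) (a b : ℝ), a ^ 2 = 1 / 2 → b ^ 2 = 1 / 2 → R (EuclideanSpace.single 0 1) = a • EuclideanSpace.single 0 1 + b • EuclideanSpace.single 1 1 → (SchwingerFamily.toLabelled (fun n => (S₁ n).comp (linActMulti R))).IsReflectionPositive)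 →
    (let E := EuclideanSpace ℝ (Fin 4); ∀ (G : Type) [Group G] [TopologicalSpace G] [IsTopologicalGroup G] [CompactSpace G], IsCompactSimpleLieGroup G → letI : MeasurableSpace G := borel G; haveI : BorelSpace G := ⟨rfl⟩; let W₁ := fun (r : LatticeRep G) (sch : SpeciesScheme (YMSpecies G)) (S₁ : SchwingerFamily E) => ((∀ (n : ℕ), n ≠ 0 → ∀ (f : Fin n → SchwartzMap (E) ℝ) (F : SchwartzMap (Fin n → E) ℂ), IsTensorOf F (fun i => ofRealTest (f i)) → IsOffDiagonal F → Filter.Tendsto (fun k : ℕ => ((latticeSchwinger r.ρ sch (fun s => s.F) k n (fun _ => r.curvature) f : ℝ) : ℂ)) Filter.atTop (nhds (S₁ n F))) ∧ (S₁.toLabelled.IsNormalized ∧ S₁.toLabelled.IsHermitian ∧ S₁.toLabelled.HasLinearGrowth ∧ S₁.toLabelled.IsReflectionPositive ∧ S₁.toLabelled.IsSymmetric ∧ S₁.toLabelled.HasClusterProperty) ∧ (∀ (n : ℕ) (a : E) (F : SchwartzMap (Fin n → E) ℂ), IsOffDiagonal F → S₁ n (translateMulti a F) = S₁ n F) ∧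 (∀ (R : E ≃ₗᵢ[ℝ] E), LinearMap.det (R.toLinearEquiv : E →ₗ[ℝ] E) = 1 → (∀ i : Fin 4, ∃ j : Fin 4, R (EuclideanSpace.single i 1) = EuclideanSpace.single j 1 ∨ R (EuclideanSpace.single i 1) = -EuclideanSpace.single j 1) → ∀ (n : ℕ) (F : SchwartzMap (Fin n → E) ℂ), IsOffDiagonal F → S₁ n (linActMulti R F) = S₁ n F) ∧ (∃ Δ : ℝ, 0 < Δ ∧ S₁.toLabelled.HasMassGap Δ ∧ HasLatticeMassGap r sch Δ)); ∀ (r : LatticeRep G) (sch : SpeciesScheme (YMSpecies G)) (S₁ : SchwingerFamily E), W₁ r sch S₁ → ∀ (R : E ≃ₗᵢ[ℝ] E) (a b : ℝ), a ^ 2 = 1 / 2 → b ^ 2 = 1 / 2 → R (EuclideanSpace.single 0 1) = a • EuclideanSpace.single 0 1 + b • EuclideanSpace.single 1 1 → (SchwingerFamily.toLabelled (fun n => (S₁ n).comp (linActMulti R))).IsReflectionPositive) := by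
  intro hP hC hB E G _ _ _ _ hG W₁ r sch S₁ hW₁ R a b ha hb hR
  letI : MeasurableSpace G := borel G
  haveI : BorelSpace G := ⟨rfl⟩
  obtain ⟨hconv, hpkg, htr, hhyp, Δ, hΔ, hgap, hlat⟩ := hW₁
  obtain ⟨φ, hφ, hcase⟩ := exists_subseq_sign_dichotomy sch.β
  obtain ⟨sch', hls, hβ, hgap'⟩ := exists_subseqScheme r sch φ hφ
  -- the curvature package of the subsequence scheme
  have hW₁' : W₁ r sch' S₁ := by
    refine ⟨?_, hpkg, htr, hhyp, Δ, hΔ, hgap, hgap' Δ hlat⟩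
    intro n hn f F hF hoff
    have h := (hconv n hn f F hF hoff).comp hφ.tendsto_atTop
    refine h.congr (fun k => ?_)
    simp only [Function.comp_apply, hls]
  rcases hcase with hpos | hneg
  · have hpos' : ∀ k : ℕ, 0 ≤ sch'.β k := by rw [hβ]; exact hpos
    exact hP G hG r sch' S₁ hW₁' hpos' R a b ha hb hR
  · have hneg' : ∀ k : ℕ, sch'.β k < 0 := by rw [hβ]; exact hneg
    by_cases hz : ∃ z ∈ Subgroup.center G, r.ρ z = -1
    · exact hC G hG r sch' S₁ hW₁' hz hneg' R a b ha hb hR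
    · exact hB G hG r sch' S₁ hW₁' hz hneg' R a b ha hb hR

/-- **Composition `DiagonalMirrorRPR_of`**: the registered stubs `stub_nonnegCouplings → stub_centreNegCouplings → stub_centreBlindNegCouplings`
give the crux BY NAME (MirrorModularBoosts' decl = the item's decl of record; the ONLY theorem here concluding that decl, so the skeleton audit
is unambiguous; `DiagonalMirrorRPR_of_subs` above is the children ⇒ crux-body form). NOT to be staffed: leaf misstated, repair pending. [folklore] -/
theorem DiagonalMirrorRPR_of : Summit.QuantumFields.YangMills.Theses.MirrorModularBoosts.DiagonalMirrorRPR :=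
  DiagonalMirrorRPR_of_subs stub_nonnegCouplings stub_centreNegCouplings stub_centreBlindNegCouplings

/-! ## The two other routes sharing the item (bodies verbatim identical) -/

/-- PencilRigidity's copy of the crux is the same proposition (verbatim body). [folklore] -/
theorem shared_iff_PencilRigidity :
    Summit.QuantumFields.YangMills.Theses.PencilRigidity.DiagonalMirrorRPR ↔
      Summit.QuantumFields.YangMills.Theses.MirrorModularBoosts.DiagonalMirrorRPR := Iff.rfl

/-- IsotropyFromPowerCounting's copy of the crux is the same proposition (verbatim body). [folklore] -/
theorem shared_iff_IsotropyFromPowerCounting :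
    Summit.QuantumFields.YangMills.Theses.IsotropyFromPowerCounting.DiagonalMirrorRPR ↔
      Summit.QuantumFields.YangMills.Theses.MirrorModularBoosts.DiagonalMirrorRPR := Iff.rfl

/-- **Composition for route PencilRigidity**: its crux decl BY NAME (same proposition). [folklore] -/
theorem DiagonalMirrorRPR_of_PencilRigidity : Summit.QuantumFields.YangMills.Theses.PencilRigidity.DiagonalMirrorRPR :=
  DiagonalMirrorRPR_of

/-- **Composition for route IsotropyFromPowerCounting**: its crux decl BY NAME (same proposition). [folklore] -/
theorem DiagonalMirrorRPR_of_IsotropyFromPowerCounting :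
    Summit.QuantumFields.YangMills.Theses.IsotropyFromPowerCounting.DiagonalMirrorRPR :=
  DiagonalMirrorRPR_of

/-- Sanity (each child is WEAKER than the crux, so the split loses nothing): the crux implies all three children. [folklore] -/
theorem children_of_crux (h : Summit.QuantumFields.YangMills.Theses.MirrorModularBoosts.DiagonalMirrorRPR) :
    NonnegCouplings ∧ CentreNegCouplings ∧ CentreBlindNegCouplings := by
  refine ⟨?_, ?_, ?_⟩
  · intro G _ _ _ _ hG W₁ r sch S₁ hW _
    exact h G hG r sch S₁ hW
  · intro G _ _ _ _ hG W₁ r sch S₁ hW _ _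
    exact h G hG r sch S₁ hW
  · intro G _ _ _ _ hG W₁ r sch S₁ hW _ _
    exact h G hG r sch S₁ hW

end Summit.QuantumFields.YangMills.Cruxes.DiagonalMirrorRPR.SignCentreTrichotomy

end
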